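import Literature.NumberTheory.NumberFields.PureCubicOrder
import Literature.NumberTheory.CubicFields.PureCubicLatticeCodes
import HarnessLib

/-!
# The embeddings of a pure cubic field `ℚ(∛(ab²))`

Topic `Literature/NumberTheory/NumberFields`; sequel of `PureCubicOrder.lean`. A cubic number field
`K ∋ θ`, `θ³ = m`, has a REAL embedding `σ₁` (the degree is odd), under which `σ₁ θ = m^{1/3}` is
the real cube root (and `σ₁ (θ²/b) = (a²b)^{1/3}` when `m = ab²`), and a NON-REAL embedding `σ₂`
(if all three embeddings were real at `θ` they would all send `θ` to `m^{1/3} > 0`, contradicting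
`Tr θ = 0`): signature `(1, 1)`. Consequently the value of an element code
`e = (x, y, z, den)` under `σ₁` is the real number `(x + y (ab²)^{1/3} + z (a²b)^{1/3}) / den` on
which the floating-point layer operates (`real_embedding_val`).

## References

* H. Cohen, *A Course in Computational Algebraic Number Theory*, GTM 138, Springer 1993, §6.4.5.
  [Cohen1993]
-/

namespace Literature.NumberTheory.NumberFields

open scoped NumberField ComplexConjugate
open NumberField Module

namespace PureCubic

variable {K : Type*} [Field K] [NumberField K]

/-- **Real cube roots are unique**: `r³ = m ≥ 0` forces `r = m^{1/3}`. [folklore] -/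
theorem eq_rpow_third_of_pow_three_eq {r m : ℝ} (hm : 0 ≤ m) (h : r ^ 3 = m) : r = m ^ ((1 : ℝ) / 3) := by
  have hr : 0 ≤ r := by
    by_contra hcon
    push Not at hcon
    have : r ^ 3 < 0 := Odd.pow_neg (by decide) hcon
    linarith
  rw [← h, one_div, show (3 : ℝ) = ((3 : ℕ) : ℝ) by norm_num, Real.pow_rpow_inv_natCast hr (by norm_num)]

/-- **A cubic field has a real embedding** (the number of real places is odd). [folklore] -/
theorem nonempty_ringHom_real (hdeg : finrank ℚ K = 3) : Nonempty (K →+* ℝ) := by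
  classical
  have hodd : Odd (finrank ℚ K) := by rw [hdeg]; decide
  obtain ⟨w⟩ := Fintype.card_pos_iff.mp (InfinitePlace.nrRealPlaces_pos_of_odd_finrank hodd)
  exact ⟨InfinitePlace.embedding_of_isReal w.2⟩

omit [NumberField K] in
/-- **A real embedding sends a cube root of `m : ℕ` to the real cube root `m^{1/3}`.** [folklore] -/
theorem real_embedding_apply (σ : K →+* ℝ) {m : ℕ} {θ : K} (hθ : θ ^ 3 = (m : K)) :
    σ θ = (m : ℝ) ^ ((1 : ℝ) / 3) :=
  eq_rpow_third_of_pow_three_eq (Nat.cast_nonneg m) (by rw [← map_pow, hθ, map_natCast])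

/-- The same for `θ₂ = θ²/b`, `θ³ = ab²`: `σ θ₂ = (a²b)^{1/3}`. [folklore] -/
theorem real_embedding_apply_theta₂ (σ : K →+* ℝ) {a b : ℕ} {θ : K} (hab : Squarefree (a * b))
    (hθ : θ ^ 3 = ((a * b ^ 2 : ℕ) : K)) :
    σ (θ ^ 2 / (b : K)) = ((a ^ 2 * b : ℕ) : ℝ) ^ ((1 : ℝ) / 3) := by
  rw [show a ^ 2 * b = b * a ^ 2 by ring]
  exact real_embedding_apply σ (theta₂_pow_three hab hθ)

/-- **The real value of an element code**: for `θ³ = ab²` and a real embedding `σ`,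
`σ ((x + yθ + zθ₂)/den) = (x + y (ab²)^{1/3} + z (a²b)^{1/3}) / den`. [folklore] -/
theorem real_embedding_val (σ : K →+* ℝ) {a b : ℕ} {θ : K} (hab : Squarefree (a * b))
    (hθ : θ ^ 3 = ((a * b ^ 2 : ℕ) : K)) (e : ℤ × ℤ × ℤ × ℕ) :
    σ (Literature.NumberTheory.CubicFields.PureCubicCodes.val θ b e) =
      ((((e).1 : ℤ) : ℝ) + (((e).2.1 : ℤ) : ℝ) * (((a * b ^ 2 : ℕ) : ℝ) ^ ((1 : ℝ) / 3)) +
        (((e).2.2.1 : ℤ) : ℝ) * (((a ^ 2 * b : ℕ) : ℝ) ^ ((1 : ℝ) / 3))) / (((e).2.2.2 : ℕ) : ℝ) := by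
  simp only [Literature.NumberTheory.CubicFields.PureCubicCodes.val, map_div₀, map_add, map_mul, map_intCast,
    map_natCast, real_embedding_apply σ hθ, real_embedding_apply_theta₂ σ hab hθ]

/-- **A cubic field with a cube root of a positive integer of trace zero has a non-real embedding.**
If every embedding `φ : K →+* ℂ` were real at `θ` (`θ³ = m`, `m ≠ 0`), all three would send `θ` to
the real cube root of `m`, so `Tr θ = 3 m^{1/3} ≠ 0`. [folklore] -/
theorem exists_nonreal_embedding (hdeg : finrank ℚ K = 3) {m : ℕ} (hm : m ≠ 0) {θ : K} (hθ : θ ^ 3 = (m : K))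
    (htr : Algebra.trace ℚ K θ = 0) : ∃ σ : K →+* ℂ, ∃ z : K, starRingEnd ℂ (σ z) ≠ σ z := by
  classical
  by_contra hcon
  push Not at hcon
  set t : ℝ := (m : ℝ) ^ ((1 : ℝ) / 3) with ht
  have ht0 : 0 < t := Real.rpow_pos_of_pos (by exact_mod_cast Nat.pos_of_ne_zero hm) _
  have hall : ∀ φ : K →ₐ[ℚ] ℂ, φ θ = (t : ℂ) := by
    intro φ
    have hreal : conj (φ θ) = φ θ := hcon φ.toRingHom θ
    obtain ⟨r, hr⟩ := Complex.conj_eq_iff_real.mp hreal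
    have hr3 : r ^ 3 = m := by
      have h : (φ θ) ^ 3 = (r : ℂ) ^ 3 := by rw [hr]
      rw [← map_pow, hθ, map_natCast] at h
      exact_mod_cast h.symm
    rw [hr, eq_rpow_third_of_pow_three_eq (Nat.cast_nonneg m) hr3]
  have hsum := trace_eq_sum_embeddings ℂ (K := ℚ) (L := K) (x := θ)
  rw [htr, map_zero, Finset.sum_congr rfl fun φ _ => hall φ, Finset.sum_const, Finset.card_univ,
    AlgHom.card ℚ K ℂ, hdeg] at hsum
  have : (3 : ℂ) * t = 0 := by simpa using hsum.symm
  have ht0' : (t : ℂ) ≠ 0 := by exact_mod_cast ht0.ne'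
  exact ht0' (by simpa using this)

/-- **Signature `(1,1)` of `ℚ(∛(ab²))`**: for `ab` squarefree, `ab ≠ 1` and a cubic field `K ∋ θ`,
`θ³ = ab²`, there are a real embedding `σ₁` and a non-real embedding `σ₂`. [cite: Cohen1993, §6.4.5] -/
theorem exists_embeddings_pair (hdeg : finrank ℚ K = 3) {a b : ℕ} (hab : Squarefree (a * b)) (hab1 : a * b ≠ 1)
    {θ : K} (hθ : θ ^ 3 = ((a * b ^ 2 : ℕ) : K)) :
    ∃ (_ : K →+* ℝ) (σ₂ : K →+* ℂ), ∃ z : K, starRingEnd ℂ (σ₂ z) ≠ σ₂ z := by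
  obtain ⟨σ₁⟩ := nonempty_ringHom_real hdeg
  obtain ⟨ha0, hb0⟩ := ne_zero_of_squarefree_mul hab
  have hm : a * b ^ 2 ≠ 0 := mul_ne_zero ha0 (pow_ne_zero 2 hb0)
  have htr : Algebra.trace ℚ K θ = 0 := by
    have h := trace_order hdeg hab hab1 hθ 0 1 0
    simpa using h
  obtain ⟨σ₂, hσ₂⟩ := exists_nonreal_embedding hdeg hm hθ htr
  exact ⟨σ₁, σ₂, hσ₂⟩

end PureCubic

end Literature.NumberTheory.NumberFields
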